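import Literature.InformationTheory.QuantumCodes.IntegerProgrammingBoundAdditive
import Literature.InformationTheory.QuantumCodes.RefinedWeightEnumerator
import HarnessLib

/-!
# CRSS's linear program refined with respect to a codeword (§7 (ii)): the integer system and its proof

Topic `Literature/InformationTheory/QuantumCodes` (venture QEC, cell `qec`, row 06 / rung X1). «(ii) No `[[18,12,3]]`
code exists. Consider the `(18, 2⁶)` additive code `C`. Linear programming shows that `C` must contain a vector of
weight 12, which without loss of generality we may take to be `u₀ = 0⁶1¹²`. We define the refined weight enumerator of
`C` with respect to `u₀` … By applying linear programming, we find that the weight distribution of `C` must be either …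
or … . In either case, adding these constraints to the refined weight enumerator produces a linear program with no
feasible solution.» [CalderbankEtAl1998, §7 (ii), printed p. 28]. This file types that LINEAR PROGRAM once, for every
`(n,k,d)` and every weight `w₀` of the reference codeword, as a feasibility statement in NATURAL numbers (so the integer
side information of (i) rides along), and proves it for every additive code containing a word of weight `w₀`:

* `CRSSIntSystem n k d A B W e` — the clauses of `CRSSIntFeasible` on explicit unknowns (`CRSSIntFeasible` is literally
  `∃ A B W e, CRSSIntSystem …`), with `IsAdditiveCode.crssIntSystem` exhibiting the witnesses `A = wtDist C`,
  `B = wtDist C⊥`, `W = wtDist (C′)⊥`, `e = log₂ [C : C′]` (needed to add the case information `A_{w₀} = 0`);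
* `CRSSRefinedSystem n k d w₀ A B R R'` — the refined part: `R, R' : ℕ³ → ℕ` (refined distributions of `C`, `C⊥`
  relative to `u₀`) have the marginals `A`, `B`; satisfy the refined MacWilliams identity
  `2^{n−k} R'(x) = R(T x)` AT EVERY INTEGER POINT `x ∈ ℤ⁵` (the polynomial identity of
  `RefinedWeightEnumerator.card_mul_refEnum_sympDual` evaluated; certificates pick finitely many points); vanish for odd
  `c` («`c(u) ≡ 0 (mod 2)`») and outside the box; are invariant under `(a,b,c) ↦ (a, w₀−b−c, c)` (translation by
  `u₀`); `R ≤ R'` with equality below `d`; `R(0,0,0) = 1`, `R(0,w₀,0) = 1`;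
* `CRSSRefinedFeasible n k d w₀ := ∃ …, CRSSIntSystem ∧ CRSSRefinedSystem` and
  `IsAdditiveCode.crssRefinedFeasible (hu₀ : u₀ ∈ S̄) (hw₀ : wt u₀ = w₀)`.

Deliberately NOT here: any specific `(n,k,d)`; the certificates (Summits-side `RefinedIPCertificate.lean`). HONEST
FRAMING: necessary conditions for existence; nothing here certifies a distance. Reference: [CalderbankEtAl1998]
A. R. Calderbank, E. M. Rains, P. W. Shor, N. J. A. Sloane, IEEE Trans. Inform. Theory 44 (1998) 1369–1387 =
arXiv:quant-ph/9608006v5, §7 Thm. 21 and (i)–(iii) after Thm. 22 (printed pp. 26–28).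
-/

namespace Literature.InformationTheory.QuantumCodes

open Finset

/-! ### 1. The plain integer system on explicit unknowns -/

/-- The clauses of `CRSSIntFeasible n k d` for explicit unknowns `A, B, W, e` (see that definition).
[cite: CalderbankEtAl1998, §7 Thm. 21 eqs. (16)–(21) and example (i) (printed pp. 26–28)] -/
def CRSSIntSystem (n k d : ℕ) (A B W : ℕ → ℕ) (e : ℕ) : Prop :=
  e ≤ 1 ∧
    A 0 = 1 ∧ A 1 = 0 ∧
    ∑ j ∈ range (n + 1), A j = 2 ^ (n - k) ∧
    2 ^ e * ∑ j ∈ (range (n + 1)).filter Even, A j = 2 ^ (n - k) ∧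
    (∀ j, j ≤ n → (2 : ℤ) ^ (n - k) * B j = ∑ r ∈ range (n + 1), krawtchouk4 n j r * A r) ∧
    (∀ j, j ≤ n →
      (2 : ℤ) ^ (n - k) * W j = 2 ^ e * ∑ r ∈ (range (n + 1)).filter Even, krawtchouk4 n j r * A r) ∧
    (∀ j, j < d → A j = B j) ∧
    (∀ j, j ≤ n → A j ≤ B j) ∧
    (∀ j, j ≤ n → B j ≤ W j) ∧
    (k = 0 → ∀ j, 1 ≤ j → j < d → A j = 0)

/-- `CRSSIntFeasible` is the existential closure of `CRSSIntSystem` (by definition). [cite: CalderbankEtAl1998, §7 Thm. 21] -/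
theorem crssIntFeasible_iff (n k d : ℕ) :
    CRSSIntFeasible n k d ↔ ∃ (A B W : ℕ → ℕ) (e : ℕ), CRSSIntSystem n k d A B W e := Iff.rfl

section Plain

variable {n : ℕ}

open scoped Classical in
/-- `log₂ [C : C′]`: `0` if the even-weight subcode is all of `C`, else `1`. [cite: CalderbankEtAl1998, §7 Thm. 21 eq. (20)] -/
noncomputable def evenIndexExp (S : Submodule (ZMod 2) (SympVec n)) (hS : IsSelfOrthogonal S) : ℕ :=
  if #(codeWords (evenSub S hS)) = #(codeWords S) then 0 else 1

open scoped Classical in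
/-- **The plain integer system with its witnesses named**: for an additive code without weight-one stabilizer words,
`(A, B, W, e) = (wtDist C, wtDist C⊥, wtDist (C′)⊥, log₂[C:C′])` satisfies `CRSSIntSystem n k d` (the proof of
`IsAdditiveCode.crssIntFeasible`, with the witnesses exposed so that case information such as `A_{w₀} = 0` can be
added). Column: PROVED. [cite: CalderbankEtAl1998, §7 Thm. 21 with its proof (printed p. 26)] -/
theorem IsAdditiveCode.crssIntSystem {k d : ℕ} {S : Submodule (ZMod 2) (SympVec n)} (h : IsAdditiveCode S k d)
    (hw1 : ∀ v ∈ S, sympWeight v ≠ 1) :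
    CRSSIntSystem n k d (fun j => wtDist S j) (fun j => wtDist (sympDual S) j)
      (fun j => wtDist (sympDual (evenSub S h.1)) j) (evenIndexExp S h.1) := by
  classical
  have hS : IsSelfOrthogonal S := h.1
  have hNk : Module.finrank (ZMod 2) S = n - k := by have := h.2.1; omega
  have hcard : #(codeWords S) = 2 ^ (n - k) := by rw [card_codeWords S, hNk]
  have hce := card_evenSub S hS
  have he1 : evenIndexExp S hS ≤ 1 := by unfold evenIndexExp; split_ifs <;> omega
  have hidx : 2 ^ evenIndexExp S hS * #(codeWords (evenSub S hS)) = #(codeWords S) := by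
    unfold evenIndexExp
    split_ifs with hall
    · rw [pow_zero, one_mul, hall]
    · rcases hce with hall' | hhalf
      · exact absurd hall' hall
      · rw [pow_one]; exact hhalf
  have hidx' : 2 ^ evenIndexExp S hS * #(codeWords (evenSub S hS)) = 2 ^ (n - k) := hidx.trans hcard
  refine ⟨he1, wtDist_zero S, wtDist_one_eq_zero hw1, ?_, ?_, ?_, ?_, ?_, ?_, ?_, ?_⟩
  · rw [sum_wtDist_eq_card, hcard]
  · rw [sum_wtDist_even_eq_card S hS, hidx']
  · intro j _
    rw [sum_krawtchouk4_mul_wtDist S j, hcard]; push_cast; ring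
  · intro j _
    rw [sum_even_krawtchouk4_mul_wtDist S hS j, ← mul_assoc]
    have h2 : (2 : ℤ) ^ evenIndexExp S hS * (#(codeWords (evenSub S hS)) : ℤ) = (2 : ℤ) ^ (n - k) := by
      exact_mod_cast hidx'
    rw [h2]
  · intro j hjd; exact wtDist_eq_wtDist_sympDual h hjd
  · intro j _; exact wtDist_le_wtDist_sympDual hS j
  · intro j _; exact wtDist_sympDual_mono (evenSub_le S hS) j
  · intro hk j hj1 hjd
    subst hk
    exact wtDist_eq_zero_of_isAdditiveCode_zero h hj1 hjd

end Plain

/-! ### 2. The refined part -/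

/-- The refined monomial `x₀^{m−a} x₁^a y₀^{w₀−b−c} y₁^b y₂^c` (`m = n − w₀`), evaluated at integers.
[cite: CalderbankEtAl1998, §7 (ii) (printed p. 28, definition of `R_C`)] -/
def refMono (m w₀ : ℕ) (x₀ x₁ y₀ y₁ y₂ : ℤ) (a b c : ℕ) : ℤ :=
  x₀ ^ (m - a) * x₁ ^ a * (y₀ ^ (w₀ - b - c) * y₁ ^ b * y₂ ^ c)

/-- The refined polynomial of a distribution `X : ℕ³ → ℕ` at an integer point, summed over the box
`a ≤ m`, `b ≤ w₀`, `c ≤ w₀`. [cite: CalderbankEtAl1998, §7 (ii) (printed p. 28)] -/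
def refPoly (m w₀ : ℕ) (X : ℕ → ℕ → ℕ → ℕ) (x₀ x₁ y₀ y₁ y₂ : ℤ) : ℤ :=
  ∑ a ∈ range (m + 1), ∑ b ∈ range (w₀ + 1), ∑ c ∈ range (w₀ + 1), (X a b c : ℤ) * refMono m w₀ x₀ x₁ y₀ y₁ y₂ a b c

/-- **The refined system relative to a codeword of weight `w₀`** (CRSS §7 (ii)), on explicit unknowns: `A, B` the
weight distributions of `C`, `C⊥` and `R, R' : ℕ³ → ℕ` their refined distributions. Clauses (`m = n − w₀`):
marginals `Σ_{a+b+c=j} R = A_j`, `Σ_{a+b+c=j} R' = B_j` (`j ≤ n`, sums over the box); the refined MacWilliams identity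
`2^{n−k} R'(x) = R(x₀+3x₁, x₀−x₁, y₀+y₁+2y₂, y₀+y₁−2y₂, y₀−y₁)` at EVERY `x ∈ ℤ⁵`; `R = R' = 0` for odd `c`
(«`c(u) ≡ 0 (mod 2)`») and outside `a ≤ m`, `b + c ≤ w₀`; translation symmetry `X(a,b,c) = X(a, w₀−b−c, c)` for
`b + c ≤ w₀` (`X = R, R'`: «`(a(u+u₀), b(u+u₀), c(u+u₀)) = (a(u), 12−b(u)−c(u), c(u))`»); `R ≤ R'` with equality for
`a + b + c < d` (`C ⊆ C⊥`, low-weight dual words lie in `C`); `R(0,0,0) = 1` (the zero word) and `R(0,w₀,0) = 1`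
(`u₀` itself). Column: definition (the paper's refined LP as an integer feasibility system).
[cite: CalderbankEtAl1998, §7 (ii) (printed p. 28)] -/
def CRSSRefinedSystem (n k d w₀ : ℕ) (A B : ℕ → ℕ) (R R' : ℕ → ℕ → ℕ → ℕ) : Prop :=
  (∀ j, j ≤ n → ∑ a ∈ range (n - w₀ + 1), ∑ b ∈ range (w₀ + 1), ∑ c ∈ range (w₀ + 1),
      (if a + b + c = j then R a b c else 0) = A j) ∧
  (∀ j, j ≤ n → ∑ a ∈ range (n - w₀ + 1), ∑ b ∈ range (w₀ + 1), ∑ c ∈ range (w₀ + 1),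
      (if a + b + c = j then R' a b c else 0) = B j) ∧
  (∀ x₀ x₁ y₀ y₁ y₂ : ℤ, (2 : ℤ) ^ (n - k) * refPoly (n - w₀) w₀ R' x₀ x₁ y₀ y₁ y₂ =
      refPoly (n - w₀) w₀ R (x₀ + 3 * x₁) (x₀ - x₁) (y₀ + y₁ + 2 * y₂) (y₀ + y₁ - 2 * y₂) (y₀ - y₁)) ∧
  (∀ a b c, Odd c → R a b c = 0 ∧ R' a b c = 0) ∧
  (∀ a b c, (n - w₀ < a ∨ w₀ < b + c) → R a b c = 0 ∧ R' a b c = 0) ∧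
  (∀ a b c, b + c ≤ w₀ → R a b c = R a (w₀ - b - c) c ∧ R' a b c = R' a (w₀ - b - c) c) ∧
  (∀ a b c, R a b c ≤ R' a b c) ∧
  (∀ a b c, a + b + c < d → R a b c = R' a b c) ∧
  R 0 0 0 = 1 ∧ R 0 w₀ 0 = 1

/-- **CRSS's LP refined w.r.t. a codeword of weight `w₀`, with integrality, is feasible.**
[cite: CalderbankEtAl1998, §7 (ii) (printed p. 28)] -/
def CRSSRefinedFeasible (n k d w₀ : ℕ) : Prop :=
  ∃ (A B W : ℕ → ℕ) (e : ℕ) (R R' : ℕ → ℕ → ℕ → ℕ), CRSSIntSystem n k d A B W e ∧ CRSSRefinedSystem n k d w₀ A B R R'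

section Refined

variable {n : ℕ}

/-- `refPoly` of a refined distribution is the refined enumerator evaluated at integers (when `wt u₀ = w₀`).
[cite: CalderbankEtAl1998, §7 (ii) (printed p. 28)] -/
theorem refPoly_refDist (S : Submodule (ZMod 2) (SympVec n)) (u₀ : SympVec n) (x₀ x₁ y₀ y₁ y₂ : ℤ) :
    refPoly (n - sympWeight u₀) (sympWeight u₀) (refDist S u₀) x₀ x₁ y₀ y₁ y₂ = refEnum S u₀ x₀ x₁ y₀ y₁ y₂ := by
  rw [refEnum_eq_sum_refDist]
  rfl

open scoped Classical in
/-- **Every additive code containing a word `u₀` of weight `w₀` solves the refined system** (with the plain system):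
witnesses `A = wtDist C`, `B = wtDist C⊥`, `W = wtDist (C′)⊥`, `e = log₂[C:C′]`, `R = refDist C u₀`,
`R' = refDist C⊥ u₀`. The refined identity is `card_mul_refEnum_sympDual` at integer points; the parity is
«`c(u) ≡ 0 (mod 2)`» (`u₀ ∈ C ⊆ C⊥⊥`); the symmetry is translation by `u₀ ∈ C ⊆ C⊥`. Column: PROVED.
[cite: CalderbankEtAl1998, §7 (ii) (printed p. 28)] -/
theorem IsAdditiveCode.crssRefinedFeasible {k d w₀ : ℕ} {S : Submodule (ZMod 2) (SympVec n)}
    (h : IsAdditiveCode S k d) (hw1 : ∀ v ∈ S, sympWeight v ≠ 1) {u₀ : SympVec n} (hu₀ : u₀ ∈ S)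
    (hw₀ : sympWeight u₀ = w₀) : CRSSRefinedFeasible n k d w₀ := by
  classical
  have hS : IsSelfOrthogonal S := h.1
  have hNk : Module.finrank (ZMod 2) S = n - k := by have := h.2.1; omega
  have hcard : #(codeWords S) = 2 ^ (n - k) := by rw [card_codeWords S, hNk]
  have hu₀' : u₀ ∈ sympDual S := hS hu₀
  subst hw₀
  refine ⟨_, _, _, _, refDist S u₀, refDist (sympDual S) u₀, h.crssIntSystem hw1, ?_, ?_, ?_, ?_, ?_, ?_, ?_, ?_,
    refDist_zero S u₀, refDist_self hu₀⟩
  -- marginals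
  · intro j _; exact sum_refDist_eq_wtDist S u₀ j
  · intro j _; exact sum_refDist_eq_wtDist (sympDual S) u₀ j
  -- the refined MacWilliams identity at integer points
  · intro x₀ x₁ y₀ y₁ y₂
    rw [refPoly_refDist, refPoly_refDist, ← card_mul_refEnum_sympDual S u₀, hcard]
    push_cast; ring
  -- parity of `c`
  · intro a b c hc
    refine ⟨?_, refDist_sympDual_eq_zero_of_odd hu₀ hc⟩
    have := refDist_le_refDist_sympDual hS u₀ a b c
    have h0 := refDist_sympDual_eq_zero_of_odd hu₀ hc (a := a) (b := b)
    omega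
  -- support
  · intro a b c habc
    exact ⟨refDist_eq_zero_of_not_mem habc, refDist_eq_zero_of_not_mem habc⟩
  -- translation symmetry
  · intro a b c hbc
    exact ⟨refDist_translate hu₀ hbc, refDist_translate hu₀' hbc⟩
  -- containment
  · intro a b c; exact refDist_le_refDist_sympDual hS u₀ a b c
  · intro a b c habc; exact refDist_eq_refDist_sympDual h u₀ habc

/-- **The refined LP bound as a nonexistence principle.** If for some weight `w₀` the refined system is infeasible,
then every additive code (without weight-one stabilizer words) has NO codeword of weight `w₀`: `A_{w₀} = 0`.
[cite: CalderbankEtAl1998, §7 (ii) (printed p. 28)] -/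
theorem IsAdditiveCode.wtDist_eq_zero_of_not_crssRefinedFeasible {k d w₀ : ℕ} {S : Submodule (ZMod 2) (SympVec n)}
    (h : IsAdditiveCode S k d) (hw1 : ∀ v ∈ S, sympWeight v ≠ 1) (hw₀ : ¬ CRSSRefinedFeasible n k d w₀) :
    wtDist S w₀ = 0 := by
  classical
  rw [wtDist, Finset.card_eq_zero, Finset.filter_eq_empty_iff]
  intro v hv hvw
  exact hw₀ (h.crssRefinedFeasible hw1 (mem_codeWords.1 hv) hvw)

end Refined

end Literature.InformationTheory.QuantumCodes
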